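import Literature.Computability.Complexity.IKWTableGenerator
import Literature.Computability.Complexity.CircuitSizeProofs
import HarnessLib

/-!
# An `EXP`-language average-case hard infinitely often for every polynomial size, from a language
# without polynomial-size circuits (Babai–Fortnow–Nisan–Wigderson 1993, the "low end")

Literature / complexity — the input of the case `EXP ⊄ P/poly` of Impagliazzo–Wigderson 1998
(`UniformDerandomizationNonuniform.frequently_abs_seedAvg_sub_unifAvg_lt`,
`Learning/IWPadGeneratorFools.uniformPRG_of_ioAvgHard`): from a language `L` whose circuit complexity
exceeds every polynomial infinitely often (`∀ p, ∃^∞ m, L.circuitSize m > p(m)` — the content of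
`L ∉ P/poly`, see `frequently_lt_circuitSize_of_not_mem_PPoly`), an EXPLICIT language `hardLang L` whose
slices are **infinitely often average-case hard for every polynomial size**:
`∀ c, ∃^∞ n', H_avg(hardLang L ↾ {0,1}^{n'}) ≥ n'^c` (`frequently_avgHardAtLeast_hardLang`).

The amplification is the tree's: `IKWTableGenerator.lean` proves, for every `f : {0,1}^m → {0,1}` and
every target `n`, that the Impagliazzo–Wigderson / Healy–Vadhan–Viola amplification `g₂ = IKWGen.g2 f n`
of the low-degree-extension bits of `f` has `H_avg(g₂) ≥ S₂(n) ≥ n` as soon as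
`circuitSize(f) > sizeBound m n`, a polynomial in `n + m` (`IKWGen.avgHard_g2`, `sizeBound_le`). That
amplification is TUNED to the target `n` (the number of XOR blocks grows with `n`), whereas the
generator against uniform tests needs ONE function per length beating every polynomial level
infinitely often. The standard remedy is to interleave all tunings along the input lengths: the slice
of `hardLang L` at length `n' = ⟨j, 40(m+2)⟩` (Cantor pairing) is `g₂` for `f = L↾{0,1}^m` and target
`n = (m+2)^j`, read off the first `L₂(m, n)` input bits. For a level `n'^c` one FIXES `j₀ = 13c + 1`;
along the lengths `n'(m) = ⟨j₀, 40(m+2)⟩ = 1600(m+2)² + j₀` the hardness is `≥ (m+2)^{j₀} ≥ n'^c + 2`,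
at every `m` where `L` beats the polynomial `Z · ((m+2)^{j₀} + m + 2)^{66}` — infinitely many.

* `avgHardAtLeast_prefix` — average-case hardness passes to the function reading a prefix of a longer
  input (hard-wiring the best suffix, `MildHard.exists_circuit_prefix`; the level drops by the two
  constant gates);
* `lenCode`, `mOf`, `jOf`, `tgtOf`, `hardBitAt`, **`hardLang L`**, `sliceFn_hardLang` — the interleaved
  language and its slices;
* **`frequently_avgHardAtLeast_hardLang`** — the i.o. average-case hardness for every polynomial size;
* `frequently_lt_circuitSize_of_not_mem_PPoly` — `L ∉ P/poly` iff-style unpacking: every polynomial is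
  beaten infinitely often (finitely many exceptional lengths are patched with trivial circuits,
  `mem_SIZE_iff_circuitSize_le`); `exists_hard_of_not_EXP_subset_PPoly` — under `EXP ⊄ P/poly` some
  `L ∈ DTIME(2^{n^b})` qualifies.

The time bound `hardLang L ∈ EXP` for `L ∈ EXP` (the machine evaluating `g₂` from the table of
`L↾{0,1}^m`, cf. `IKWGenMachine.lean`) is a separate file. Everything here is proved; the definitions
are plain (no named facts).

## References

* L. Babai, L. Fortnow, N. Nisan, A. Wigderson, *BPP has subexponential time simulations unless EXPTIME
  has publishable proofs*, Comput. Complexity 3 (1993) 307–318, §4 (random self-reducibility and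
  hardness amplification in `EXP`; cited through IW 2001 §2.1 and van Melkebeek Thm. 2.3.7, not held).
* [ImpagliazzoWigderson2001] R. Impagliazzo, A. Wigderson, JCSS 63 (2001), §2.1 ("since [BFNW] show
  that `BPP ⊆ i.o.-SUBEXP` assuming `EXP ⊄ P/poly`, we can assume `EXP ⊂ P/poly`").
* [ImpagliazzoKabanetsWigderson2002] R. Impagliazzo, V. Kabanets, A. Wigderson, JCSS 65 (2002), Thm. 11
  (the tree's amplification chain, `IKWTableGenerator.lean`).
* [ImpagliazzoWigderson1997] R. Impagliazzo, A. Wigderson, STOC 1997, Thm. 1.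
* [AroraBarakCC2009] S. Arora, B. Barak, CUP 2009, Thm. 19.21, §19.1 (hardness amplification), Def. 6.5.
* [VanMelkebeek2000] D. van Melkebeek, LNCS 1950 (2000), Thm. 2.3.7 (p. 37), Thm. 6.2.1 (p. 142).
-/

noncomputable section

namespace Literature.Computability.Complexity

open Finset Filter Polynomial MetaComplexity IKWGen

namespace IoHard

/-! ### Hardness of the function reading a prefix -/

/-- **Average-case hardness passes to a padded input**: if `H_avg(g) ≥ S > 2` on `a` bits and `a ≤ n'`,
then `u ↦ g(u↾a)` on `n'` bits has `H_avg ≥ S − 2` (a circuit on `n'` bits agreeing with the padded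
function on a fraction `α` has, for the best hard-wired suffix, a restriction on `a` bits of size `+2`
agreeing with `g` on `≥ α`). [cite: AroraBarakCC2009, Thm. 19.21 (proof, footnote 5: padding)] -/
theorem avgHardAtLeast_prefix {a n' : ℕ} (h : a ≤ n') (g : (Fin a → Bool) → Bool) {S : ℝ} (hS : 2 < S)
    (hg : AvgHardAtLeast g S) :
    AvgHardAtLeast (fun u : Fin n' → Bool => g fun i => u (Fin.castLE h i)) (S - 2) := by
  classical
  intro C hB hs
  obtain ⟨C', hB', hs', herr⟩ := MildHard.exists_circuit_prefix h C hB g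
  have hsize : (C'.size : ℝ) ≤ S := by
    have : (C'.size : ℝ) ≤ C.size + 2 := by exact_mod_cast hs'
    linarith
  have hhard := hg C' hB' hsize
  -- error counts: `err(C') · 2^{n'-a} ≤ err(C)`
  have hN : a + (n' - a) = n' := Nat.add_sub_cancel' h
  have hcardA : Fintype.card (Fin a → Bool) = 2 ^ a := by simp
  have hcardN : Fintype.card (Fin n' → Bool) = 2 ^ n' := by simp
  have hsplitA : (#{w' : Fin a → Bool | C'.eval w' = g w'} : ℝ) = 2 ^ a - #{w' : Fin a → Bool | C'.eval w' ≠ g w'} := by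
    have := Finset.card_filter_add_card_filter_not (s := (Finset.univ : Finset (Fin a → Bool)))
      (fun w' => C'.eval w' = g w')
    rw [Finset.card_univ, hcardA] at this
    have e : (Finset.univ.filter fun w' : Fin a → Bool => ¬C'.eval w' = g w') =
        Finset.univ.filter fun w' : Fin a → Bool => C'.eval w' ≠ g w' := rfl
    rw [e] at this
    have := congrArg (fun x : ℕ => (x : ℝ)) this
    push_cast at this
    linarith
  have hsplitN : (#{w : Fin n' → Bool | C.eval w = g fun i => w (Fin.castLE h i)} : ℝ) =
      2 ^ n' - #{w : Fin n' → Bool | C.eval w ≠ g fun i => w (Fin.castLE h i)} := by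
    have := Finset.card_filter_add_card_filter_not (s := (Finset.univ : Finset (Fin n' → Bool)))
      (fun w => C.eval w = g fun i => w (Fin.castLE h i))
    rw [Finset.card_univ, hcardN] at this
    have e : (Finset.univ.filter fun w : Fin n' → Bool => ¬C.eval w = g fun i => w (Fin.castLE h i)) =
        Finset.univ.filter fun w : Fin n' → Bool => C.eval w ≠ g fun i => w (Fin.castLE h i) := rfl
    rw [e] at this
    have := congrArg (fun x : ℕ => (x : ℝ)) this
    push_cast at this
    linarith
  have herrR : (#{w' : Fin a → Bool | C'.eval w' ≠ g w'} : ℝ) * 2 ^ (n' - a) ≤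
      #{w : Fin n' → Bool | C.eval w ≠ g fun i => w (Fin.castLE h i)} := by exact_mod_cast herr
  have h2 : (2 : ℝ) ^ n' = 2 ^ a * 2 ^ (n' - a) := by rw [← pow_add, hN]
  -- agreements: `agr(C, padded) ≤ agr(C', g) < 1/2 + 1/S ≤ 1/2 + 1/(S-2)`
  unfold agreement at hhard ⊢
  rw [hcardA] at hhard
  rw [hcardN, hsplitN]
  rw [hsplitA] at hhard
  push_cast at hhard ⊢
  have hle : ((2 : ℝ) ^ n' - #{w : Fin n' → Bool | C.eval w ≠ g fun i => w (Fin.castLE h i)}) / 2 ^ n' ≤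
      ((2 : ℝ) ^ a - #{w' : Fin a → Bool | C'.eval w' ≠ g w'}) / 2 ^ a := by
    rw [div_le_div_iff₀ (by positivity) (by positivity), h2]
    nlinarith [herrR, pow_pos (two_pos : (0 : ℝ) < 2) a, pow_pos (two_pos : (0 : ℝ) < 2) (n' - a)]
  have hS2 : 1 / S ≤ 1 / (S - 2) := one_div_le_one_div_of_le (by linarith) (by linarith)
  linarith

/-! ### The interleaved language -/

/-- The length encoding the tuning exponent `j` and the source length `m`: `⟨j, 40(m+2)⟩`. [folklore] -/
def lenCode (m j : ℕ) : ℕ := Nat.pair j (40 * (m + 2))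

/-- The source length decoded from an input length. [folklore] -/
def mOf (n' : ℕ) : ℕ := (Nat.unpair n').2 / 40 - 2

/-- The tuning exponent decoded from an input length. [folklore] -/
def jOf (n' : ℕ) : ℕ := (Nat.unpair n').1

/-- The amplification target `n = (m+2)^j` at an input length. [folklore] -/
def tgtOf (n' : ℕ) : ℕ := (mOf n' + 2) ^ jOf n'

/-- Decoding the source length. [folklore] -/
@[simp] theorem mOf_lenCode (m j : ℕ) : mOf (lenCode m j) = m := by
  simp [mOf, lenCode, Nat.unpair_pair]

/-- Decoding the tuning exponent. [folklore] -/
@[simp] theorem jOf_lenCode (m j : ℕ) : jOf (lenCode m j) = j := by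
  simp [jOf, lenCode, Nat.unpair_pair]

/-- Decoding the target. [folklore] -/
@[simp] theorem tgtOf_lenCode (m j : ℕ) : tgtOf (lenCode m j) = (m + 2) ^ j := by
  simp [tgtOf]

/-- `⟨j, 40(m+2)⟩ = 1600 (m+2)² + j` once `j < 40 (m+2)`. [folklore] -/
theorem lenCode_eq {m j : ℕ} (hj : j < 40 * (m + 2)) : lenCode m j = 1600 * (m + 2) ^ 2 + j := by
  unfold lenCode Nat.pair
  rw [if_pos hj]
  ring

/-- `m ≤ ⟨j, 40(m+2)⟩`. [folklore] -/
theorem le_lenCode (m j : ℕ) : m ≤ lenCode m j :=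
  le_trans (by omega) (Nat.right_le_pair j (40 * (m + 2)))

/-- **The hard bit of a string at length `n'`**: the amplified function `g₂` of the slice `L↾{0,1}^m`,
target `(m+2)^j`, on the first `L₂` bits (`(m, j)` decoded from `n'`; junk-free: out-of-range bits read
as `0`). [cite: ImpagliazzoKabanetsWigderson2002, Thm. 11] -/
def hardBitAt (L : Language Bool) (n' : ℕ) (w : List Bool) : Bool :=
  g2 (L.sliceFn (mOf n')) (tgtOf n') fun i => w.getD i false

/-- **The interleaved hard language.** [cite: ImpagliazzoWigderson2001, §2.1] -/
def hardLang (L : Language Bool) : Language Bool := {w | hardBitAt L w.length w = true}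

variable (L : Language Bool)

/-- The slices of `hardLang L`, as read by the generator. [folklore] -/
theorem sliceFn_hardLang_apply (n' : ℕ) (u : Fin n' → Bool) :
    (hardLang L).sliceFn n' u = hardBitAt L n' (List.ofFn u) := by
  have hmem : List.ofFn u ∈ hardLang L ↔ hardBitAt L n' (List.ofFn u) = true := by
    show hardBitAt L (List.ofFn u).length (List.ofFn u) = true ↔ _
    rw [List.length_ofFn]
  unfold Language.sliceFn
  by_cases hb : hardBitAt L n' (List.ofFn u) = true
  · rw [(Set.mem_iff_boolIndicator _ _).1 (hmem.2 hb), hb]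
  · rw [Bool.not_eq_true] at hb
    have hn : List.ofFn u ∉ hardLang L := fun hw => by
      have := hmem.1 hw; rw [hb] at this; exact Bool.false_ne_true this
    rw [(Set.notMem_iff_boolIndicator _ _).1 hn, hb]

/-- **The slice at length `n'` is the padded amplified function** whenever `L₂ ≤ n'`. [folklore] -/
theorem sliceFn_hardLang {n' : ℕ} (hle : L2 (mOf n') (tgtOf n') ≤ n') :
    (hardLang L).sliceFn n' = fun u : Fin n' → Bool =>
      g2 (L.sliceFn (mOf n')) (tgtOf n') fun i => u (Fin.castLE hle i) := by
  funext u
  rw [sliceFn_hardLang_apply, hardBitAt]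
  congr 1
  funext i
  have hi : (i : ℕ) < (List.ofFn u).length := by rw [List.length_ofFn]; exact lt_of_lt_of_le i.isLt hle
  rw [List.getD_eq_getElem _ _ hi, List.getElem_ofFn]
  rfl

/-! ### Infinitely often average-case hard for every polynomial size -/

/-- `1 ≤ Z`. [folklore] -/
theorem one_le_Z : 1 ≤ Z := by
  unfold Z
  have := one_le_γ
  have := one_le_κ
  have h1 : 1 ≤ γ ^ 2 := Nat.one_le_pow _ _ one_le_γ
  have h2 : 1 ≤ κ ^ 2 := Nat.one_le_pow _ _ one_le_κ
  calc 1 ≤ 432 * 16 ^ 6 * 78 := by norm_num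
    _ ≤ 432 * 16 ^ 6 * 78 * γ ^ 2 := Nat.le_mul_of_pos_right _ h1
    _ ≤ 432 * 16 ^ 6 * 78 * γ ^ 2 * κ ^ 2 := Nat.le_mul_of_pos_right _ h2

/-- `S₂(n) ≥ n + 2` for `n ≥ 1`. [folklore] -/
theorem add_two_le_S2 {n : ℕ} (hn : 1 ≤ n) : n + 2 ≤ S2 n := by
  unfold S2
  have : n + 2 ≤ n * univBound (ell n) + n + 2 := by omega
  calc n + 2 ≤ 1 * (n * univBound (ell n) + n + 2) := by omega
    _ ≤ n * (n * univBound (ell n) + n + 2) := Nat.mul_le_mul_right _ hn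

/-- `(1600(m+2)² + j)^c ≤ (m+2)^{13c}` for `j ≤ (m+2)²`. [folklore] -/
theorem lenCode_pow_le {m j c : ℕ} (hj : j ≤ (m + 2) ^ 2) :
    (1600 * (m + 2) ^ 2 + j) ^ c ≤ (m + 2) ^ (13 * c) := by
  have h1 : 1600 * (m + 2) ^ 2 + j ≤ 1601 * (m + 2) ^ 2 := by omega
  have h2 : 1601 ≤ (m + 2) ^ 11 := le_trans (by norm_num) (Nat.pow_le_pow_left (by omega : 2 ≤ m + 2) 11)
  calc (1600 * (m + 2) ^ 2 + j) ^ c ≤ (1601 * (m + 2) ^ 2) ^ c := Nat.pow_le_pow_left h1 c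
    _ ≤ ((m + 2) ^ 11 * (m + 2) ^ 2) ^ c := Nat.pow_le_pow_left (Nat.mul_le_mul_right _ h2) c
    _ = (m + 2) ^ (13 * c) := by rw [← pow_add, ← pow_mul]

/-- **`hardLang L` is infinitely often average-case hard for every polynomial size** when `L` beats every
polynomial circuit size infinitely often. [cite: ImpagliazzoWigderson2001, §2.1]
[cite: ImpagliazzoKabanetsWigderson2002, Thm. 11] [cite: ImpagliazzoWigderson1997, Thm. 1]
[cite: AroraBarakCC2009, Thm. 19.21] -/
theorem frequently_avgHardAtLeast_hardLang (hL : ∀ p : Polynomial ℕ, ∃ᶠ m in atTop, p.eval m < L.circuitSize m)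
    (c : ℕ) : ∃ᶠ n' in atTop, AvgHardAtLeast ((hardLang L).sliceFn n') ((n' : ℝ) ^ c) := by
  -- the tuning exponent and the polynomial to beat
  set j₀ : ℕ := 13 * c + 1 with hj₀
  set P : Polynomial ℕ := Polynomial.C Z * ((X + 2) ^ j₀ + X + 2) ^ 66 with hP
  have hPev : ∀ m, P.eval m = Z * ((m + 2) ^ j₀ + m + 2) ^ 66 := by intro m; simp [hP]
  -- transfer along `m ↦ ⟨j₀, 40(m+2)⟩`
  have htend : Tendsto (fun m => lenCode m j₀) atTop atTop :=
    tendsto_atTop_mono (fun m => le_lenCode m j₀) tendsto_id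
  refine htend.frequently (((hL P).and_eventually (eventually_ge_atTop j₀)).mono ?_)
  rintro m ⟨hsize, hm⟩
  -- notation
  have hj40 : j₀ < 40 * (m + 2) := by omega
  have hlen := lenCode_eq hj40
  have hmOf : mOf (lenCode m j₀) = m := mOf_lenCode m j₀
  have htgt : tgtOf (lenCode m j₀) = (m + 2) ^ j₀ := tgtOf_lenCode m j₀
  have hn1 : 1 ≤ (m + 2) ^ j₀ := Nat.one_le_pow _ _ (by omega)
  -- the amplified function is strongly hard on average
  have hT : T m ((m + 2) ^ j₀) ≤ P.eval m := by
    rw [hPev]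
    have h1 : T m ((m + 2) ^ j₀) ≤ T m ((m + 2) ^ j₀) ^ 66 := by
      conv_lhs => rw [← pow_one (T m ((m + 2) ^ j₀))]
      exact Nat.pow_le_pow_right (by unfold T; omega) (by norm_num)
    calc T m ((m + 2) ^ j₀) ≤ T m ((m + 2) ^ j₀) ^ 66 := h1
      _ ≤ Z * T m ((m + 2) ^ j₀) ^ 66 := Nat.le_mul_of_pos_left _ one_le_Z
  have hsb : sizeBound m ((m + 2) ^ j₀) < circuitSizeOver B2 (L.sliceFn m) :=
    lt_of_le_of_lt ((sizeBound_le m _).trans (by rw [hPev])) hsize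
  have hhard := avgHard_g2 (L.sliceFn m) ((m + 2) ^ j₀) hn1 hsb
  -- the input length of `g₂` fits below `n'`
  have hTle : (m + 2) ^ j₀ + m + 2 ≤ P.eval m := hT
  have hTlt : T m ((m + 2) ^ j₀) < 2 ^ (m + 3) :=
    T_lt_two_pow (c₀ := 1) le_rfl (f := L.sliceFn m)
      (by rw [pow_one]; change _ < L.circuitSize m; omega)
  have hL2 : L2 m ((m + 2) ^ j₀) ≤ lenCode m j₀ := by
    rw [hlen]; have := L2_le m ((m + 2) ^ j₀) hTlt; omega
  have hle : L2 (mOf (lenCode m j₀)) (tgtOf (lenCode m j₀)) ≤ lenCode m j₀ := by rwa [hmOf, htgt]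
  -- the slice is the padded `g₂`, hard at level `S₂ - 2`
  have hS2 : ((m + 2) ^ j₀ : ℝ) + 2 ≤ (S2 ((m + 2) ^ j₀) : ℝ) := by exact_mod_cast add_two_le_S2 hn1
  have hS2' : (2 : ℝ) < S2 ((m + 2) ^ j₀) := by
    have : (1 : ℝ) ≤ (m + 2 : ℝ) ^ j₀ := by exact_mod_cast hn1
    linarith
  have hpad := avgHardAtLeast_prefix hle (g2 (L.sliceFn (mOf (lenCode m j₀))) (tgtOf (lenCode m j₀)))
    (S := (S2 ((m + 2) ^ j₀) : ℝ)) hS2' (by rw [hmOf, htgt]; exact hhard)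
  rw [← sliceFn_hardLang L hle] at hpad
  -- the level `n'^c ≤ (m+2)^{13c} ≤ (m+2)^{j₀} ≤ S₂ - 2`
  have hpos : (0 : ℝ) < ((lenCode m j₀ : ℕ) : ℝ) ^ c :=
    pow_pos (by rw [hlen]; positivity) c
  refine hpad.mono hpos ?_
  have h1 : (lenCode m j₀) ^ c ≤ (m + 2) ^ (13 * c) := by
    rw [hlen]; exact lenCode_pow_le (le_trans hm (by nlinarith))
  have h2 : (m + 2) ^ (13 * c) ≤ (m + 2) ^ j₀ := Nat.pow_le_pow_right (by omega) (by omega)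
  have h3 : ((lenCode m j₀ : ℕ) : ℝ) ^ c ≤ ((m + 2) ^ j₀ : ℕ) := by exact_mod_cast h1.trans h2
  push_cast at h3 ⊢
  linarith

/-! ### The worst-case input: `L ∉ P/poly` -/

/-- **`L ∉ P/poly` unpacked**: every polynomial is beaten by the circuit complexity of `L` at infinitely
many lengths (if `L.circuitSize m ≤ p(m)` for all `m ≥ m₀`, the finitely many smaller lengths have
circuits of size `≤ univBound m₀`, so `L ∈ SIZE(p + univBound m₀) ⊆ P/poly`).
[cite: AroraBarakCC2009, Def. 6.5] -/
theorem frequently_lt_circuitSize_of_not_mem_PPoly {L : Language Bool} (hL : L ∉ PPoly) (p : Polynomial ℕ) :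
    ∃ᶠ m in atTop, p.eval m < L.circuitSize m := by
  by_contra hnot
  rw [Filter.not_frequently] at hnot
  simp only [not_lt] at hnot
  obtain ⟨m₀, hm₀⟩ := eventually_atTop.1 hnot
  apply hL
  refine Set.mem_iUnion.2 ⟨p + Polynomial.C (univBound m₀), ?_⟩
  refine (mem_SIZE_iff_circuitSize_le_holds L _).2 fun m => ?_
  rw [eval_add, eval_C]
  by_cases hm : m₀ ≤ m
  · exact (hm₀ m hm).trans (Nat.le_add_right _ _)
  · have h1 : L.circuitSize m ≤ univBound m := circuitSizeOver_le_univBound _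
    have h2 : univBound m ≤ univBound m₀ := univBound_mono (by omega)
    omega

/-- **Under `EXP ⊄ P/poly` some language in `DTIME(2^{n^b})` beats every polynomial circuit size
infinitely often.** [cite: ImpagliazzoWigderson2001, §2.1] [cite: AroraBarakCC2009, Def. 6.5] -/
theorem exists_hard_of_not_EXP_subset_PPoly (h : ¬ EXP ⊆ PPoly) :
    ∃ (L : Language Bool) (b : ℕ), L ∈ DTIME (fun n => 2 ^ n ^ b) ∧
      ∀ p : Polynomial ℕ, ∃ᶠ m in atTop, p.eval m < L.circuitSize m := by
  obtain ⟨L, hLE, hLP⟩ := Set.not_subset.1 h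
  obtain ⟨b, hb⟩ := Set.mem_iUnion.1 hLE
  exact ⟨L, b, hb, frequently_lt_circuitSize_of_not_mem_PPoly hLP⟩

end IoHard

end Literature.Computability.Complexity

end
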